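import Summits.Parity.GeneralizedHardyLittlewood.Theorems.FordMaynardSieveConst01651SieveConst01651PairingTwoFaces
import Summits.Parity.GeneralizedHardyLittlewood.Theorems.FordMaynardSieveConst01651SieveConst01651CertCellSplit
import HarnessLib

/-!
# Route `FordMaynardSieveConst01651`, target `SieveConst01651` (stmt-Parity-19185), stub `stub_certValuePos` (R2):
# `S⁰_2(t)` as a sum of cell integrals over the table entries

Def-free helper file (step (3) of the `certP`/`certN` soundness, see `…CertAssembly`).  For `t ∉ {c₀, 1/2}`,

  `S⁰_2(t) = Σ_{e ∈ certG2} (c_e/10⁶) · ∫_{u ∈ (0,t)} 𝟙_{P_e}(t,u)/(u(t−u)) du`   (`sliceFnOrd_two_eq_entry_sum`),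

from `…PairingTwoFaces.sliceFnOrd_two_eq_tab`, `…ConeCuts.sliceFnOrd_two`, the pointwise split
`…CertCellSplit.gTab_two_integrand_eq_sum` and the integrability of each cell term (bounded by `1/ν₀²`, measurable):
`integral_list_sum_of_integrable`, `measurableSet_entryCond`, `integrableOn_entryTerm`.

References: [FordMaynard2024PrimeSieves] arXiv:2407.14368, §8.2.
-/

noncomputable section

open MeasureTheory Set
open scoped Classical
open Literature.NumberTheory.Sieve Literature.NumberTheory.Sieve.FordMaynard

namespace Summit.Parity.GeneralizedHardyLittlewood.FordMaynardSieveConst01651SieveConst01651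

/-- Integral of a finite list sum of integrable functions. [folklore] -/
theorem integral_list_sum_of_integrable {ι : Type*} {μ : Measure ℝ} (F : ι → ℝ → ℝ) :
    ∀ l : List ι, (∀ e ∈ l, Integrable (F e) μ) →
      ∫ x, (l.map fun e => F e x).sum ∂μ = (l.map fun e => ∫ x, F e x ∂μ).sum ∧
        Integrable (fun x => (l.map fun e => F e x).sum) μ
  | [], _ => by simp
  | e :: l, h => by
    obtain ⟨ih1, ih2⟩ := integral_list_sum_of_integrable F l fun e' he' => h e' (List.mem_cons_of_mem _ he')
    have he := h e List.mem_cons_self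
    simp only [List.map_cons, List.sum_cons]
    exact ⟨by rw [integral_add he ih2, ih1], he.add ih2⟩

/-- The entry condition `P_e(t, ·)` cuts out a measurable set of `u`. [folklore] -/
theorem measurableSet_entryCond (t : ℝ) (e : ℕ × ℕ × ℕ × ℤ) :
    MeasurableSet {u : ℝ | ((certEdge e.1 : ℚ) : ℝ) < u ∧ u < ((certEdge (e.1 + 1) : ℚ) : ℝ) ∧
      ((certEdge e.2.1 : ℚ) : ℝ) < t - u ∧ t - u < ((certEdge (e.2.1 + 1) : ℚ) : ℝ) ∧
      u ≤ t - u ∧ (if e.2.2.1 = 0 then t < 8349 / 20000 else 8349 / 20000 < t) ∧ t < 1 / 2} := by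
  have hsub : Measurable fun u : ℝ => t - u := measurable_const.sub measurable_id
  refine (measurableSet_lt measurable_const measurable_id).inter
    ((measurableSet_lt measurable_id measurable_const).inter
    ((measurableSet_lt measurable_const hsub).inter
    ((measurableSet_lt hsub measurable_const).inter
    ((measurableSet_le measurable_id hsub).inter
    ((MeasurableSet.const _).inter (MeasurableSet.const _))))))

/-- Each cell term `𝟙_{P_e}(t,u)/(u(t−u))` is integrable on `(0, t)` (bounded by `1/ν₀²`). [folklore] -/
theorem integrableOn_entryTerm (t : ℝ) (e : ℕ × ℕ × ℕ × ℤ) (κ : ℝ) :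
    IntegrableOn (fun u : ℝ => κ *
      (if ((certEdge e.1 : ℚ) : ℝ) < u ∧ u < ((certEdge (e.1 + 1) : ℚ) : ℝ) ∧
          ((certEdge e.2.1 : ℚ) : ℝ) < t - u ∧ t - u < ((certEdge (e.2.1 + 1) : ℚ) : ℝ) ∧
          u ≤ t - u ∧ (if e.2.2.1 = 0 then t < 8349 / 20000 else 8349 / 20000 < t) ∧ t < 1 / 2
        then 1 / (u * (t - u)) else 0)) (Set.Ioo 0 t) := by
  have hν : (0 : ℝ) < 1651 / 10000 := by norm_num
  have hmeas : Measurable (fun u : ℝ => κ *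
      (if ((certEdge e.1 : ℚ) : ℝ) < u ∧ u < ((certEdge (e.1 + 1) : ℚ) : ℝ) ∧
          ((certEdge e.2.1 : ℚ) : ℝ) < t - u ∧ t - u < ((certEdge (e.2.1 + 1) : ℚ) : ℝ) ∧
          u ≤ t - u ∧ (if e.2.2.1 = 0 then t < 8349 / 20000 else 8349 / 20000 < t) ∧ t < 1 / 2
        then 1 / (u * (t - u)) else 0)) :=
    measurable_const.mul (Measurable.ite (measurableSet_entryCond t e)
      (measurable_const.div (measurable_id.mul (measurable_const.sub measurable_id))) measurable_const)
  refine Measure.integrableOn_of_bounded (M := |κ| * (1 / (1651 / 10000) ^ 2)) measure_Ioo_lt_top.ne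
    hmeas.aestronglyMeasurable ((ae_restrict_iff' measurableSet_Ioo).2 (Filter.Eventually.of_forall fun u _ => ?_))
  rw [Real.norm_eq_abs, abs_mul]
  refine mul_le_mul_of_nonneg_left ?_ (abs_nonneg _)
  by_cases h : ((certEdge e.1 : ℚ) : ℝ) < u ∧ u < ((certEdge (e.1 + 1) : ℚ) : ℝ) ∧
      ((certEdge e.2.1 : ℚ) : ℝ) < t - u ∧ t - u < ((certEdge (e.2.1 + 1) : ℚ) : ℝ) ∧
      u ≤ t - u ∧ (if e.2.2.1 = 0 then t < 8349 / 20000 else 8349 / 20000 < t) ∧ t < 1 / 2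
  · rw [if_pos h]
    have hu : (1651 / 10000 : ℝ) < u := lt_of_le_of_lt (nu_le_certEdge _) h.1
    have htu : (1651 / 10000 : ℝ) < t - u := lt_of_le_of_lt (nu_le_certEdge _) h.2.2.1
    have hpos : 0 < u * (t - u) := mul_pos (hν.trans hu) (hν.trans htu)
    rw [abs_of_pos (one_div_pos.2 hpos), one_div_le_one_div hpos (by positivity), sq]
    exact mul_le_mul hu.le htu.le hν.le (hν.trans hu).le
  · rw [if_neg h, abs_zero]; positivity

/-- **`S⁰_2(t)` as a sum over the table entries** (`t ∉ {c₀, 1/2}`). [cite: FordMaynard2024PrimeSieves, §8.2] -/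
theorem sliceFnOrd_two_eq_entry_sum {t : ℝ} (ht1 : t ≠ 8349 / 20000) (ht2 : t ≠ 1 / 2) :
    sliceIntegral 2 t
        (fun v => if (∀ i, (1651 / 10000 : ℝ) < v i) ∧ Monotone v then coneCert 2 v / ∏ i, v i else 0) =
      (certG2.map fun e => ∫ u in Set.Ioo 0 t, ((e.2.2.2 : ℤ) : ℝ) / 1000000 *
        (if ((certEdge e.1 : ℚ) : ℝ) < u ∧ u < ((certEdge (e.1 + 1) : ℚ) : ℝ) ∧
            ((certEdge e.2.1 : ℚ) : ℝ) < t - u ∧ t - u < ((certEdge (e.2.1 + 1) : ℚ) : ℝ) ∧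
            u ≤ t - u ∧ (if e.2.2.1 = 0 then t < 8349 / 20000 else 8349 / 20000 < t) ∧ t < 1 / 2
          then 1 / (u * (t - u)) else 0)).sum := by
  rw [sliceFnOrd_two_eq_tab ht1 ht2, sliceFnOrd_two (1651 / 10000) gTab t]
  have hpt : ∀ u, (if (1651 / 10000 : ℝ) < u ∧ u ≤ t - u then gTab 2 ![u, t - u] / (u * (t - u)) else 0) =
      (certG2.map fun e => ((e.2.2.2 : ℤ) : ℝ) / 1000000 *
        (if ((certEdge e.1 : ℚ) : ℝ) < u ∧ u < ((certEdge (e.1 + 1) : ℚ) : ℝ) ∧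
            ((certEdge e.2.1 : ℚ) : ℝ) < t - u ∧ t - u < ((certEdge (e.2.1 + 1) : ℚ) : ℝ) ∧
            u ≤ t - u ∧ (if e.2.2.1 = 0 then t < 8349 / 20000 else 8349 / 20000 < t) ∧ t < 1 / 2
          then 1 / (u * (t - u)) else 0)).sum := fun u => gTab_two_integrand_eq_sum ht1
  simp_rw [hpt]
  exact (integral_list_sum_of_integrable (μ := volume.restrict (Set.Ioo 0 t)) _ certG2
    (fun e _ => integrableOn_entryTerm t e _)).1

end Summit.Parity.GeneralizedHardyLittlewood.FordMaynardSieveConst01651SieveConst01651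

end
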